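import Literature.Probability.Percolation.SlabRSWSnapLayoutGadgets
import Literature.Probability.Percolation.SlabRSWSnapDirect
import HarnessLib

/-!
# Newman–Tassion–Wu 2017, Lemma 3.16 — the local modification for the coarse-grained datum

Topic: `Literature/Probability/Percolation`. The gadget supply for `Q₂ = snapGlue k n hn Γ`
(`SlabRSWSnapDatum.lean`), i.e. NTW's "the domain `K_□` is regular enough to apply Theorem 3.6"
(Remark 2 after Theorem 3.7) for the coarse-grained domain `R' ∖ N(Γ)`: for every lattice
configuration `ω ∈ 𝒳 ∩ {C̄ ⟷ 𝒩(Γ̄₁, 1)}` of `Q₂` there is a local modification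
`GadgetSpec Q₂ k 14 ω ω'`. After the contact normalisation (`exists_contact`: an open path from `C̄`
whose last vertex `q` is within `1` of a vertex `g₀` of the minimal path `Γ₁`), four cases:

* (A) an `A`-cell within `13` of `ḡ₀`: direct gluing of the `C`-cluster to `Ā`
  (`SlabRSWSnapDirect.lean`);
* (C) a `C`-cell within `13` of `ḡ₀`: direct gluing of the `A`-cluster to `C̄` (ibid.);
* (TOP) `q̄` in the top `43` rows of `R'`, where no tile of `N ∪ τN` reaches: plain surgery routed in
  a `25 × (≥ 13)` rectangle (`gadget_snap_top`);
* (MAIN) otherwise: the frame of the anchor cell (`SlabRSWSnapFrame.lean`), its layout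
  (`SlabRSWSnapLayout.lean`) and the per-layout gadget (`SlabRSWSnapLayoutGadgets.lean`)
  (`gadget_snap_main`).

`exists_gadget_snap` is the dispatcher; it is the hypothesis of
`h316_of_snapGadgets_box` / `NewmanTassionWu2017_thm31_of_snapGadgets_box` with `ρ = 1`, `r = 14`,
`n₀ = 40`.

## Sources

* C. M. Newman, V. Tassion, W. Wu, *Critical percolation and the minimal spanning tree in slabs*,
  Comm. Pure Appl. Math. 70 (2017), arXiv:1512.09107: §3.2, proof of Theorem 3.7 (steps (1)–(3))
  and Remark 2; §3.5, proof of Lemma 3.16 [NewmanTassionWu2017].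
-/

noncomputable section

namespace Literature.Probability.Percolation

open MeasureTheory LatticeModels SimpleGraph

namespace NTW17

variable {k : ℕ}

section Gadget

variable {n : ℕ} (hn : 1 ≤ n) {Γ : List (slab 3 k)} {ω : BondConfig (slab 3 k)}

/-- The cell `(14n, y)`, `5n ≤ y ≤ 13n - 1`, lies in `C = τ(sideSeg 0 (5n) (13n-1))` of `Q₂`.
[cite: NewmanTassionWu2017, §3.5 (proof of Lemma 3.16, the sets Y, Y′)] -/
theorem mem_snapGlue_C {y : ℤ} (h1 : 5 * (n : ℤ) ≤ y) (h2 : y ≤ 13 * n - 1) :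
    ((14 * n : ℤ), y) ∈ (snapGlue k n hn Γ).C := by
  rw [snapGlue_C]
  exact ⟨(0, y), ⟨rfl, h1, h2⟩, by simp⟩

/-- The cell `(0, y)`, `5n ≤ y ≤ 13n - 1`, lies in `A = sideSeg 0 (5n) (13n-1)` of `Q₂`.
[cite: NewmanTassionWu2017, §3.5 (proof of Lemma 3.16, the sets Y, Y′)] -/
theorem mem_snapGlue_A {y : ℤ} (h1 : 5 * (n : ℤ) ≤ y) (h2 : y ≤ 13 * n - 1) :
    ((0 : ℤ), y) ∈ (snapGlue k n hn Γ).A := by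
  rw [snapGlue_A]; exact ⟨rfl, h1, h2⟩

/-- With no `C`-cell within `13` of `ḡ₀` and `q̄` within `1` of `ḡ₀`, no `C`-cell is within `12` of
`q̄`; in particular the contact path is non-trivial.
[cite: NewmanTassionWu2017, §3.2 (proof of Theorem 3.7, step (1))] -/
theorem contact_ne_nil_snap {c₀ q g₀ : slab 3 k} {l : List (slab 3 k)}
    (hc₀ : c₀ ∈ slabLift k (snapGlue k n hn Γ).C) (hhead : (l ++ [q]).head (by simp) = c₀)
    (hqg₀ : planar k q ∈ sqBox (planar k g₀) 1)
    (hnC : ∀ c ∈ (snapGlue k n hn Γ).C, c ∉ sqBox (planar k g₀) 13) : l ≠ [] := by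
  refine contact_ne_nil (Q := snapGlue k n hn Γ) hc₀ hhead (r := 12) fun c hc hcq => hnC c hc ?_
  rw [mem_sqBox_iff'] at hqg₀ hcq ⊢; push_cast at hqg₀ hcq ⊢; omega

/-- With no `A`-cell within `13` of `q̄` (`q̄` within `1` of `ḡ₀`), `g₀` is not the first vertex of `Γ₁`
(which lies in `Ā`).
[cite: NewmanTassionWu2017, §3.2 (definition of Γ_min)] -/
theorem ne_head_of_noA (hX : ω ∈ (snapGlue k n hn Γ).evX k) {g₀ q : slab 3 k}
    (hqg₀ : planar k q ∈ sqBox (planar k g₀) 1)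
    (hnA : ∀ a ∈ (snapGlue k n hn Γ).A, a ∉ sqBox (planar k q) 13) :
    g₀ ≠ ((snapGlue k n hn Γ).γ k ω).head ((snapGlue k n hn Γ).γ_spec hX.1).1.ne_nil := by
  intro h
  have := head_mem_A (Q := snapGlue k n hn Γ) hX.1
  rw [← h, mem_slabLift_iff] at this
  exact hnA _ this (sqBox_mono _ (by norm_num) (GlueGeom.mem_sqBox_comm hqg₀))

/-- **Case (TOP).** The contact cell lies in the top `43` rows of `R'` (and no `A`-cell is within `13`
of `q̄`, no `C`-cell within `13` of `ḡ₀`): no tile of `N ∪ τN` (rows `≤ 8n + 59`) meets the square of radius `12` around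
`q̄`, clipped at the top side of `R'`; plain surgery routed in that rectangle (`n ≥ 40`).
[cite: NewmanTassionWu2017, §3.2 (proof of Theorem 3.7, steps (1)–(3)); §3.5 (proof of Lemma 3.16)] -/
theorem gadget_snap_top (hk : 1 ≤ k) (hn₀ : 40 ≤ n)
    (hΓ : ∀ g ∈ Γ, planar k g ∈ boxR 0 (7 * n) 0 (8 * n - 1))
    (hω : ω ⊆ (slabGraph 3 k).edgeSet) (hX : ω ∈ (snapGlue k n hn Γ).evX k)
    {c₀ q : slab 3 k} {l : List (slab 3 k)} (hc₀ : c₀ ∈ slabLift k (snapGlue k n hn Γ).C)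
    (hch : (l ++ [q]).IsChain (fun a b => s(a, b) ∈ ω ∧ a ≠ b)) (hnd : (l ++ [q]).Nodup)
    (hsub : ∀ x ∈ l ++ [q], x ∈ slabLift k (snapGlue k n hn Γ).R) (hhead : (l ++ [q]).head (by simp) = c₀)
    (hfar : ∀ x ∈ l, ¬Near k ((snapGlue k n hn Γ).γ k ω) 1 (planar k x))
    {g₀ : slab 3 k} (hg₀ : g₀ ∈ (snapGlue k n hn Γ).γ k ω) (hqg₀ : planar k q ∈ sqBox (planar k g₀) 1)
    (hnA : ∀ a ∈ (snapGlue k n hn Γ).A, a ∉ sqBox (planar k q) 13)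
    (hnC : ∀ c ∈ (snapGlue k n hn Γ).C, c ∉ sqBox (planar k g₀) 13)
    (htop : 13 * (n : ℤ) - 43 ≤ (planar k q).2) :
    ∃ ω', GadgetSpec (snapGlue k n hn Γ) k 14 ω ω' := by
  set Q := snapGlue k n hn Γ with hQ
  have hA : ω ∈ Q.evAB k := hX.1
  obtain ⟨hγO, -⟩ := Q.γ_spec hA
  have hl : l ≠ [] := contact_ne_nil_snap hn hc₀ hhead hqg₀ hnC
  have hqR : 0 ≤ (planar k q).1 ∧ (planar k q).1 ≤ 14 * n ∧ 0 ≤ (planar k q).2 ∧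
      (planar k q).2 ≤ 13 * n - 1 := by
    have := hsub q (List.mem_append_right _ (List.mem_singleton_self _))
    rw [mem_slabLift_iff, hQ, snapGlue_mem_R_iff] at this; exact this
  have hγR : ∀ v ∈ Q.γ k ω, 0 ≤ (planar k v).1 ∧ (planar k v).1 ≤ 14 * n ∧ 0 ≤ (planar k v).2 ∧
      (planar k v).2 ≤ 13 * n - 1 := by
    intro v hv
    have := Q.γ_subset_R hA hv
    rw [mem_slabLift_iff, hQ, snapGlue_mem_R_iff] at this; exact this
  have hg₀R := hγR g₀ hg₀
  have hqg₀' := hqg₀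
  rw [mem_sqBox_iff'] at hqg₀'; push_cast at hqg₀'
  -- the columns: `14 ≤ q̄.1 ≤ 14n - 13` (else an `A`-cell is within `13` of `q̄` or a `C`-cell within `13` of `ḡ₀`)
  have hx1 : 14 ≤ (planar k q).1 := by
    by_contra h
    refine hnA _ (mem_snapGlue_A hn (y := (planar k q).2) (by omega) hqR.2.2.2) ?_
    rw [mem_sqBox_iff']; push_cast; omega
  have hx2 : (planar k g₀).1 ≤ 14 * n - 14 := by
    by_contra h
    refine hnC _ (mem_snapGlue_C hn (y := (planar k g₀).2) (by omega) hg₀R.2.2.2) ?_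
    rw [mem_sqBox_iff']; push_cast; omega
  -- the rectangle
  set x₁ := (planar k q).1 - 12 with hx₁
  set x₂ := (planar k q).1 + 12 with hx₂
  set y₁ := (planar k q).2 - 12 with hy₁
  set y₂ := min (13 * (n : ℤ) - 1) ((planar k q).2 + 12) with hy₂
  have hB : boxR x₁ x₂ y₁ y₂ ⊆ boxR 0 (14 * n) 0 (13 * n - 1) := by
    intro w hw; rw [mem_boxR_iff] at hw ⊢; omega
  have hBA : ∀ w ∈ boxR x₁ x₂ y₁ y₂, w ∉ Q.A := by
    intro w hw hwA; rw [mem_boxR_iff] at hw; rw [hQ, snapGlue_A] at hwA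
    obtain ⟨h1, -, -⟩ := hwA; omega
  have hBC : ∀ w ∈ boxR x₁ x₂ y₁ y₂, w ∉ Q.C := by
    intro w hw hwC; rw [mem_boxR_iff] at hw; rw [hQ, snapGlue_C] at hwC
    obtain ⟨w₀, ⟨h1, -, -⟩, rfl⟩ := hwC
    rw [planarReflect_apply] at hw; simp only at hw; omega
  have hΓ8 : ∀ g ∈ Γ, (planar k g).2 ≤ 8 * n - 1 := fun g hg => by
    have := hΓ g hg; rw [mem_boxR_iff] at this; exact this.2.2.2
  have hKM : ∀ w ∈ boxR x₁ x₂ y₁ y₂, w ∉ snapNbhd k n Γ ∧ w ∉ snapNbhdR k n Γ := by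
    intro w hw; rw [mem_boxR_iff] at hw
    exact ⟨fun h => by have := snd_le_of_mem_snapNbhd hΓ8 h; omega,
      fun h => by have := snd_le_of_mem_snapNbhdR hΓ8 h; omega⟩
  have hroute : ∀ (E₁ E₂ w : slab 3 k), planar k E₁ ∈ boxR x₁ x₂ y₁ y₂ → planar k E₂ ∈ boxR x₁ x₂ y₁ y₂ →
      planar k w ∈ boxR x₁ x₂ y₁ y₂ → E₁ ≠ E₂ → planar k E₁ ≠ planar k w → planar k E₂ ≠ planar k w →
      ∃ L Br c, RouteSpec k (boxR x₁ x₂ y₁ y₂) (boxR x₁ x₂ y₁ y₂) E₁ E₂ w L Br c :=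
    fun E₁ E₂ w hE₁ hE₂ hw hne h1 h2 =>
      exists_route (xL := x₁) (xR' := x₂) (xR := x₂) (rB := y₁) (rP := y₂) (rT := y₂) hk (by omega)
        le_rfl (by omega) le_rfl hE₁ hE₂ hw hne h1 h2
  -- two vertices of `Γ₁` over the rectangle: `g₀` and its predecessor
  obtain ⟨u, hu, huadj, hug₀, -⟩ := exists_pred hω hA hg₀ (ne_head_of_noA hn hX hqg₀ hnA)
  have hug₀' := planar_mem_sqBox_one_of_adj huadj
  rw [mem_sqBox_iff'] at hug₀'; push_cast at hug₀'
  have huR := hγR u hu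
  have htwo : ∃ x ∈ Q.γ k ω, ∃ y ∈ Q.γ k ω, x ≠ y ∧ planar k x ∈ boxR x₁ x₂ y₁ y₂ ∧
      planar k y ∈ boxR x₁ x₂ y₁ y₂ :=
    ⟨u, hu, g₀, hg₀, hug₀, by rw [mem_boxR_iff]; omega, by rw [mem_boxR_iff]; omega⟩
  have hqD : planar k q ∈ boxR x₁ x₂ y₁ y₂ ∪ (snapNbhd k n Γ ∩ boxR x₁ x₂ y₁ y₂) :=
    Or.inl (by rw [mem_boxR_iff]; omega)
  obtain ⟨sx, hsx⟩ := exists_surgery_snap hn hω hX hB hBA hBC subset_rfl hKM hroute htwo hc₀ hch hnd hsub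
    hhead hfar hl hqD (fun t _ htB htK => absurd htB htK)
  refine ⟨_, GadgetSpec.of_surgery hX sx ⟨planar k q, ?_⟩⟩
  rw [hsx]
  rintro w (hw | ⟨-, hw⟩) <;> · rw [mem_boxR_iff] at hw; rw [mem_sqBox_iff']; push_cast; omega

/-- **Case (MAIN).** The contact is below the top `43` rows, no `A`-cell is within `13` of `q̄` and no
`C`-cell within `13` of `ḡ₀`: the anchor `g⋆` (`g₀`, or its predecessor when `g₀` is the last vertex of `Γ₁`) has a frame,
the frame has a layout, and the layout has a gadget.
[cite: NewmanTassionWu2017, §3.5 (proof of Lemma 3.16, "the domain K_□ is regular enough to apply Theorem 3.6")] -/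
theorem gadget_snap_main (hk : 1 ≤ k)
    (hΓ : ∀ g ∈ Γ, planar k g ∈ boxR 0 (7 * n) 0 (8 * n - 1))
    (hω : ω ⊆ (slabGraph 3 k).edgeSet) (hX : ω ∈ (snapGlue k n hn Γ).evX k)
    {c₀ q : slab 3 k} {l : List (slab 3 k)} (hc₀ : c₀ ∈ slabLift k (snapGlue k n hn Γ).C)
    (hch : (l ++ [q]).IsChain (fun a b => s(a, b) ∈ ω ∧ a ≠ b)) (hnd : (l ++ [q]).Nodup)
    (hsub : ∀ x ∈ l ++ [q], x ∈ slabLift k (snapGlue k n hn Γ).R) (hhead : (l ++ [q]).head (by simp) = c₀)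
    (hfar : ∀ x ∈ l, ¬Near k ((snapGlue k n hn Γ).γ k ω) 1 (planar k x))
    {g₀ : slab 3 k} (hg₀ : g₀ ∈ (snapGlue k n hn Γ).γ k ω) (hqg₀ : planar k q ∈ sqBox (planar k g₀) 1)
    (hnA : ∀ a ∈ (snapGlue k n hn Γ).A, a ∉ sqBox (planar k q) 13)
    (hnC : ∀ c ∈ (snapGlue k n hn Γ).C, c ∉ sqBox (planar k g₀) 13)
    (hlow : (planar k q).2 ≤ 13 * n - 44) :
    ∃ ω', GadgetSpec (snapGlue k n hn Γ) k 14 ω ω' := by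
  set Q := snapGlue k n hn Γ with hQ
  have hA : ω ∈ Q.evAB k := hX.1
  obtain ⟨hγO, -⟩ := Q.γ_spec hA
  have hne : Q.γ k ω ≠ [] := hγO.ne_nil
  have hl : l ≠ [] := contact_ne_nil_snap hn hc₀ hhead hqg₀ hnC
  have hγR : ∀ v ∈ Q.γ k ω, 0 ≤ (planar k v).1 ∧ (planar k v).1 ≤ 14 * n ∧ 0 ≤ (planar k v).2 ∧
      (planar k v).2 ≤ 13 * n - 1 := by
    intro v hv
    have := Q.γ_subset_R hA hv
    rw [mem_slabLift_iff, hQ, snapGlue_mem_R_iff] at this; exact this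
  have hγN : ∀ v ∈ Q.γ k ω, planar k v ∉ snapNbhd k n Γ := by
    intro v hv
    have := hγO.subset v hv
    rw [mem_slabLift_iff, hQ, snapGlue_S] at this
    exact this.2
  have hγM : ∀ v ∈ Q.γ k ω, (∀ hne' : Q.γ k ω ≠ [], v ≠ (Q.γ k ω).getLast hne') →
      planar k v ∉ snapNbhd k n Γ ∪ snapNbhdR k n Γ := by
    intro v hv hvl hvM
    rcases hvM with h | h
    · exact hγN v hv h
    · exact hvl hne (eq_getLast_of_mem_B hA hv (by rw [mem_slabLift_iff, hQ, snapGlue_B]; exact ⟨h, hγN v hv⟩))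
  have hΓ3 : ∀ g ∈ Γ, 0 ≤ (planar k g).1 ∧ (planar k g).1 ≤ 7 * n ∧ 0 ≤ (planar k g).2 := fun g hg => by
    have := hΓ g hg; rw [mem_boxR_iff] at this; exact ⟨this.1, this.2.1, this.2.2.1⟩
  -- the anchor
  obtain ⟨u₀, hu₀, hu₀adj, hu₀g₀, hu₀l⟩ := exists_pred hω hA hg₀ (ne_head_of_noA hn hX hqg₀ hnA)
  obtain ⟨gs, u, hgs, hgsl, hu, hugs, huadj, hg₀gs, hpg₀⟩ : ∃ gs u : slab 3 k, gs ∈ Q.γ k ω ∧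
      (∀ hne' : Q.γ k ω ≠ [], gs ≠ (Q.γ k ω).getLast hne') ∧ u ∈ Q.γ k ω ∧ u ≠ gs ∧
      (slabGraph 3 k).Adj u gs ∧
      (g₀ = gs ∨ ((slabGraph 3 k).Adj g₀ gs ∧ ∀ hne' : Q.γ k ω ≠ [], g₀ = (Q.γ k ω).getLast hne')) ∧
      planar k gs ∈ sqBox (planar k g₀) 1 := by
    by_cases hg₀l : g₀ = (Q.γ k ω).getLast hne
    · exact ⟨u₀, g₀, hu₀, fun _ => hu₀l, hg₀, fun h => hu₀g₀ h.symm, hu₀adj.symm,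
        Or.inr ⟨hu₀adj.symm, fun _ => hg₀l⟩, planar_mem_sqBox_one_of_adj hu₀adj.symm⟩
    · exact ⟨g₀, u₀, hg₀, fun _ => hg₀l, hu₀, hu₀g₀, hu₀adj, Or.inl rfl, mem_sqBox_self _ _⟩
  obtain ⟨p, hp⟩ : ∃ p : ℤ × ℤ, planar k gs = p := ⟨_, rfl⟩
  have hpg₀' := hpg₀
  rw [hp] at hpg₀'
  have hqg₀n := hqg₀
  rw [mem_sqBox_iff'] at hpg₀' hqg₀n; push_cast at hpg₀' hqg₀n
  have hpR := hγR gs hgs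
  rw [hp] at hpR
  have hpM : p ∉ snapNbhd k n Γ ∪ snapNbhdR k n Γ := hp ▸ hγM gs hgs hgsl
  have hp4 : p.2 ≤ 13 * n - 42 := by omega
  have hF := isFrame_frame (n := n) hpR.1 hpR.2.1 hpR.2.2.1 hp4
  have hW := isFrameND_frame (n := n) hpR.1 hpR.2.1 hpR.2.2.1 hp4
  have hbx₁ := hF.hbx₁; have hbx₂ := hF.hbx₂; have hby₁ := hF.hby₁; have hby₂ := hF.hby₂
  have hBA : ∀ w ∈ boxR (fx₁ n p) (fx₂ n p) (fy₁ p) (fy₂ p), w ∉ Q.A := by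
    intro w hw hwA; rw [mem_boxR_iff] at hw
    rcases hg₀gs with hg | ⟨-, hg⟩
    · -- `g⋆ = g₀`: the box is within `13` of `q̄`
      have hpe : planar k g₀ = p := by rw [hg]; exact hp
      rw [hpe] at hqg₀n
      refine hnA w hwA ?_; rw [mem_sqBox_iff']; push_cast; omega
    · -- `g₀` is the last vertex: `ḡ₀ ∈ τN ∖ N ⊆ {x ≥ 7n + 1}`, far from `A = {x = 0}`
      have hl' := getLast_mem_B (Q := Q) hA
      rw [← hg hne, mem_slabLift_iff, hQ, snapGlue_B] at hl'
      have h7 := fst_gt_of_mem_diff (fun g hg' => (hΓ3 g hg').2.1) hl'.1 hl'.2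
      rw [hQ, snapGlue_A] at hwA
      obtain ⟨h0, -, -⟩ := hwA
      omega
  have hBC : ∀ w ∈ boxR (fx₁ n p) (fx₂ n p) (fy₁ p) (fy₂ p), w ∉ Q.C := by
    intro w hw hwC; rw [mem_boxR_iff] at hw
    refine hnC w hwC ?_; rw [mem_sqBox_iff']; push_cast; omega
  have hpU : p ∉ tileUnion (snapCentres k n Γ ∪ snapCentresR k n Γ) := by
    rw [← snapNbhd_union_eq_tileUnion]; exact hpM
  have lay := layout_of_frame hF hW (fun c hc => latCentre_union hΓ3 hc) hpU
  rw [← snapNbhd_union_eq_tileUnion] at lay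
  have ctx : LocalCtx k n hn Γ ω p (fx₁ n p) (fx₂ n p) (fy₁ p) (fy₂ p) (fX n p) (fY p) gs u g₀ c₀ q l :=
    ⟨hk, hΓ3, hω, hX, hF, hW, hpM, hBA, hBC, hgs, hp, hgsl, hu, hugs, huadj, hg₀, hg₀gs, hc₀, hch, hnd,
      hsub, hhead, hfar, hl, hqg₀⟩
  exact ctx.gadget_of_layout lay

/-- **The gadget supply for the coarse-grained datum** (NTW: "the domain `K_□` is regular enough
to apply Theorem 3.6", Remark 2 after Theorem 3.7): for `k ≥ 1`, `n ≥ 40`, every vertex list `Γ`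
with cells in `S' = [0,7n] × [0,8n-1]` and every lattice configuration `ω ∈ 𝒳 ∩ {C̄ ⟷^{R̄'} 𝒩(Γ̄₁, 1)}`
of `Q₂ = snapGlue k n hn Γ` there is a local modification `GadgetSpec Q₂ k 14 ω ω'`.
[cite: NewmanTassionWu2017, §3.5 (proof of Lemma 3.16) with §3.2 (Theorem 3.6/3.7 and Remark 2)] -/
theorem exists_gadget_snap (hk : 1 ≤ k) (hn₀ : 40 ≤ n)
    (hΓ : ∀ g ∈ Γ, planar k g ∈ boxR 0 (7 * n) 0 (8 * n - 1))
    (hω : ω ⊆ (slabGraph 3 k).edgeSet) (hXn : ω ∈ (snapGlue k n hn Γ).evXn k 1) :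
    ∃ ω', GadgetSpec (snapGlue k n hn Γ) k 14 ω ω' := by
  have hX : ω ∈ (snapGlue k n hn Γ).evX k := hXn.1
  obtain ⟨c₀, q, l, hc₀, hch, hnd, hsub, hhead, ⟨g₀, hg₀, hqg₀⟩, hfar⟩ := exists_contact hXn
  -- (A): an `A`-cell within `13` of `q̄`
  by_cases hcA : ∃ a ∈ (snapGlue k n hn Γ).A, a ∈ sqBox (planar k q) 13
  · exact gadget_snap_nearA hn (by omega) hω hX hc₀ hch hnd hsub hhead hcA
  -- (C): a `C`-cell within `13` of `ḡ₀`
  by_cases hcC : ∃ c ∈ (snapGlue k n hn Γ).C, c ∈ sqBox (planar k g₀) 13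
  · exact gadget_snap_nearC hn (by omega) hω hX hg₀ hcC
  push Not at hcA hcC
  -- (TOP) / (MAIN)
  by_cases htop : 13 * (n : ℤ) - 43 ≤ (planar k q).2
  · exact gadget_snap_top hn hk hn₀ hΓ hω hX hc₀ hch hnd hsub hhead hfar hg₀ hqg₀ hcA hcC htop
  · exact gadget_snap_main hn hk hΓ hω hX hc₀ hch hnd hsub hhead hfar hg₀ hqg₀ hcA hcC (by omega)

end Gadget

end NTW17

end Literature.Probability.Percolation
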